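import Summits.CriticalPhenomena.PercolationContinuityZ3.Theorems.Transplant.SkelPhiRootLegKG
import Summits.CriticalPhenomena.PercolationContinuityZ3.Theorems.Transplant.SkelPhiRootExcess
import HarnessLib

/-!
# N2 (frames-only node `SamePDropOfSkeletonFrm₁`, OPEN), (R) column: THE ROOT LEGS WITH THE CHAIN DATA BUILT AND THE RIM EXCESS DISCHARGED —
# `Skelφ.rootChainF_of_schedNZE` (any schedule) and the K-G twins `rootChainF_of_kgCorrE` / `rootChainF_of_kgCorrYE`

Over `rootChainF_of_schedNZ` (SkelPhiRootChainF, p347362) / `rootChainF_of_kgCorr(Y)` (SkelPhiRootLegKG, p348666): the window is centred AT THE ROOT (`w₀ := root`,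
as in the (R) wrapper), the chain data `Pd` is CONSTRUCTED (`o := root`, `Sfin := U' = (Q₀ ∪ E_{0,du}) ∩ B(root, R)`, levels `j₀ j₁ Rlev Nk`, rim
`Rim k := Skelφ.rootRim root R Pk.r₀ (window k)` — so `hPo/hPS/hRim/hcover` disappear), and the rim-excess row `hexc` is DISCHARGED by N1's law-generic
`Skelφ.real_rootRim_le` (SkelPhiRootExcess, p3-g9) from an excess radius `R₁ ≤ R − Pk.r₀` at the running density for entrance depth `ρ + 1` (the seed = the zone at
the root lies in `B(root, ρ)`) and the planar diameter `m` of the cut world off the seed, measured in any map `φe` (the skeleton map, whose cylinders are subcritical).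
What remains for the (R) wrapper are VALUE rows (kit block, counts, levels, window radii), the zone datum and links (Step I‴ via `AtQNQ`), the seed containment
`hZQ`/`hZρ`, the hop `hlink`, and the Γ rows `hreg/hdis/hTne/hlastM` + `hDm` + the excess radius `hR₁` (ROOM files / SlotsS).
builds on p205010 (kernel theorem, internal audit signed; external expert review pending) — nothing in this file uses p205010; nothing here is a claim about
the open node `SamePDropOfSkeletonFrm₁`.
Lane `prim-bschramm`, seat `prim-bschramm-p3` (gen 16; N2 design owner, (R) column owner); helper file (`--supports stmt-CriticalPhenomena-4575 --as helper`).
[cite: KozmaNitzan2024, §4 p. 28 ((32) at the root), Lemma 12 (pp. 23–25: the excess)] [cite: MartineauSevero2019, Cor. 2.2] [cite: MartineauTassion2017, §4.3 Lemma 4.2]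
-/

noncomputable section

open MeasureTheory ProbabilityTheory
open scoped ENNReal Classical

namespace Summit.CriticalPhenomena.PercolationContinuityZ3.Theorems

namespace Transplant

namespace Skelφ

open Literature.Probability.Percolation Literature.Probability.LatticeModels SimpleGraph GadgetSystem ProbeHistory HSiteScheme Contour KNCells
open KNCells.KSchA KNLevels ChainPlanar ChainPara
open Literature.Barriers.CriticalPhenomena (graphBall graphBall_mono)
open Skel (winGraph)
open SkelI (tanOff)

variable {V : Type} [DecidableEq V] [Countable V] {G : SimpleGraph V} [G.LocallyFinite] {φ : V → Site 2}

/-- **THE ROOT LEG OF ONE DIRECTION, ANY SCHEDULE, WINDOW AT THE ROOT, CHAIN DATA BUILT, RIM EXCESS DISCHARGED** (`rootChainF_of_schedNZ` with `w₀ := root`,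
`Pd := ⟨Rlev, Nk, j₀, j₁, root, U', rootRim …⟩`, `hexc` by `real_rootRim_le`). [cite: KozmaNitzan2024, §4 p. 28 ((32) at the root), Lemma 12 (p. 24)] -/
theorem rootChainF_of_schedNZE
    -- the scheme, the direction
    {A : Type*} {S : KSchA V A} (du : MDir)
    -- the skeleton map, the frame
    (hlipφ : Lip G φ) (hstep : Steps G φ) {Δ : ℕ} (hΔ : ∀ v, G.degree v ≤ Δ) {types : Finset V} (hfr : Frames G φ types) (hκ : CylConn G φ types)
    {n : ℕ} {hs : ℤ} (hn : 1 ≤ n) (c₀ : V) {σ : ℤ} (hσ : σ = 1 ∨ σ = -1) {kq : ℕ} (hκL : hs.natAbs ≤ kq * n)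
    -- the schedule, the window
    (Sc : ScheduleNP) {R r : ℕ}
    -- kit constants
    (Pk : ApronPrm) {Mz Rs KCmax rs cS cU : ℕ} (hPN : kq + 3 ≤ Pk.N) (hA : Pk.A = (Mz + 1 : ℕ) * (shearUnit n hs : ℤ) + 1)
    (hdD : Pk.d + 2 ≤ shellD Pk) (hDρ : Rs + 1 ≤ shellD Pk) (hKCmax : (shellD Pk + Mz + 1) * (kq + 1) ≤ KCmax)
    (hT : (shellD Pk : ℤ) + KCmax + Rs ≤ tanOff Pk.ℓs Pk.M)
    (hr₀ : Pk.N * (tanOff Pk.ℓs Pk.M + 2) + Pk.N * Pk.d + (KCmax + Rs) ≤ Pk.r₀) (hR : Pk.r₀ ≤ R)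
    (hrs : 1 + (Pk.N * (tanOff Pk.ℓs Pk.M + 2) + Pk.N * Pk.d + (KCmax + Rs)) ≤ rs)
    (hcS : (Pk.N + 1) * (tanOff Pk.ℓs Pk.M + 1) + (Pk.N + 1) * Pk.d + (KCmax + 1) + cU ≤ cS)
    (hreach : r + (Pk.N * (tanOff Pk.ℓs Pk.M + 1) + Pk.N * Pk.d + KCmax) ≤ Pk.r₀)
    -- the short region and the zone datum
    (Rg : V → Finset V) (hRg : ∀ c, ∀ u ∈ Rg c, u ∈ graphBall G c Rs) (hRgcard : ∀ c, (Rg c).card ≤ cU) (hcU1 : 1 ≤ cU)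
    (Λc : V → ℕ → Finset V) (kz : ℕ) (hΛRg : ∀ c, Λc c kz ⊆ Rg c) (hzconn : ∀ c, ∀ s ∈ Λc c kz, PathIn G (↑(Λc c kz) : Set V) c s)
    (hcz : ∀ c, c ∈ Λc c kz) {Rk : ℕ} (hkz : 1 ≤ kz) (hRk : cylRadMax G φ types kz (2 * KCmax) ≤ Rk) (hΛcyl : ∀ c, cylBallFin G φ c kz Rk ⊆ Λc c kz)
    -- the chain's level data (the chain data `Pd` is built here: source the root, support the world, rim := `rootRim root R Pk.r₀ (window k)`)
    {Rlev Nk j₀ j₁ : ℕ} (hj0 : tanOff Pk.ℓs Pk.M ≤ j₀) (hj : j₁ ≤ Rlev) (hRl : Rlev + 1 ≤ Sc.R')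
    (hE : j₁ + (Pk.N * (tanOff Pk.ℓs Pk.M + 1) + Pk.N * Pk.d + KCmax) ≤ Sc.R')
    {Δ' : ℕ} {δ η : ℝ} (hδ : 0 < δ) (hη : η ≤ δ / 2)
    (kk : ℕ) (hN : kk * (Δ + 1) ^ (2 * rs) ≤ Nk) (hk : (1 - (S.p : ℝ) ^ (1 + Δ * cS + cS * cU)) ^ kk ≤ δ)
    (hcount : 1 / (1 - (S.p : ℝ)) ^ (Δ' * Nk) ≤ δ * ((Finset.Icc j₀ j₁).card : ℝ))
    -- THE SEED := THE ZONE AT THE ROOT `Λc root kz` (internally connected by `hzconn`, contains the root by `hcz`): inside the root cube (so its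
    -- inside edges are edges of the wired cube `U₀`) and inside the window ball; the hop prism `Qp` in the world; the hop into the first core window
    (hZQ : Λc S.Γ.root kz ⊆ S.Γ.Q S.Γ.a₀ 0) {ρ : ℕ} (hZρ : ∀ u ∈ Λc S.Γ.root kz, u ∈ graphBall G S.Γ.root ρ) (hρR : ρ ≤ R)
    {Qp : Finset V} (hQU : Qp ⊆ (S.U0root du).filter fun y => y ∈ graphBall G S.Γ.root R)
    (hlink : 1 - δ < (bondPercolation G S.p).real (linkIn (↑Qp : Set V) (Λc S.Γ.root kz) (Win G (runX φ c₀ n hs σ) S.Γ.root (ScheduleNP.core Sc 0) R)))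
    -- the world rows (vertex form): every region window lies in `Q₀ ∪ E_{0,du}` and clears the seed; the rim; depth; the arrival cube
    (hreg : ∀ k ≤ Sc.N, ∀ u ∈ graphBall G S.Γ.root R, runX φ c₀ n hs σ u ∈ Sc.region k → u ∈ S.U0root du)
    (hdis : ∀ k ≤ Sc.N, Disjoint (Win G (runX φ c₀ n hs σ) S.Γ.root (Sc.region k) R) (Λc S.Γ.root kz))
    (hTne : ∀ k ≤ Sc.N, (Win G (runX φ c₀ n hs σ) S.Γ.root (ScheduleNP.core Sc (k + 1)) R).Nonempty)
    (hlastM : ∀ u ∈ graphBall G S.Γ.root R, runX φ c₀ n hs σ u ∈ ScheduleNP.core Sc (Sc.N + 1) → u ∈ S.Γ.M S.Γ.a₀ ((0 : Site 2) + stepVec du))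
    -- THE RIM EXCESS DEVICE (replaces `hexc`; N1's `Skelφ.real_rootRim_le`): an excess radius `R₁ ≤ R − Pk.r₀` at `S.p` for entrance depth `ρ + 1` and planar
    -- diameter `m` (in a map `φe` with subcritical cylinders), and the planar diameter of the cut world off the seed
    {φe : V → Site 2} {m R₁ : ℕ}
    (hR₁ : ∀ R', R₁ ≤ R' → ∀ (Rw : ℕ) (D' B' : Finset V), (∀ d ∈ D', d ∈ graphBall G S.Γ.root Rw) →
      (∀ d ∈ D', ∀ d' ∈ D', φe d - φe d' ∈ box 2 m) → B' ⊆ D' → (∀ a ∈ B', a ∈ graphBall G S.Γ.root (ρ + 1)) →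
        (bondPercolation G S.p).real (Skel.excess G S.Γ.root R' D' B') ≤ η)
    (hR₁R : R₁ ≤ R - Pk.r₀)
    (hDm : ∀ d ∈ ((S.U0root du).filter fun y => y ∈ graphBall G S.Γ.root R) \ Λc S.Γ.root kz,
      ∀ d' ∈ ((S.U0root du).filter fun y => y ∈ graphBall G S.Γ.root R) \ Λc S.Γ.root kz, φe d - φe d' ∈ box 2 m)
    -- THE PER-STEP PER-CENTRE PARKED-OR-ROUTED INPUT under the root-seed law (for the K-G corridor: p5-g15's `hrouteSW_kgCorr(Y)`)
    (hrouteS : ∀ k ≤ Sc.N, ∀ c : V,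
      runX φ c₀ n hs σ c ∈ Finset.Icc (Sc.lo k - ((Sc.R' : ℕ) : Site 2)) (Sc.hi k + ((Sc.R' : ℕ) : Site 2)) → c ∈ graphBall G S.Γ.root (R - r) →
      c ∈ Win G (runX φ c₀ n hs σ) S.Γ.root (ScheduleNP.core Sc (k + 1)) R ∪ rootRim (G := G) S.Γ.root R Pk.r₀ (Win G (runX φ c₀ n hs σ) S.Γ.root (Sc.region k) R) ∨
      ∃ Qt Ft : Finset V, Ft ⊆ Win G (runX φ c₀ n hs σ) S.Γ.root (ScheduleNP.core Sc (k + 1)) R ∪ rootRim (G := G) S.Γ.root R Pk.r₀ (Win G (runX φ c₀ n hs σ) S.Γ.root (Sc.region k) R) ∧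
        Qt ⊆ Win G (runX φ c₀ n hs σ) S.Γ.root (Sc.region k) R ∧
        1 - δ ^ 3 ≤ (prodBernoulli (S.W0pin G (edgesIn G (Λc S.Γ.root kz)) ((S.U0root du).filter fun y => y ∈ graphBall G S.Γ.root R))).real
          (linkIn (↑Qt : Set V) (Λc c kz) Ft)) :
    ∃ (c : V) (Rπ : ℕ) (W : Sym2 V → unitInterval) (s : Fin (Sc.N + 1) → KNLevels.TStep (winGraph G c Rπ))
      (T' : Fin (Sc.N + 1) → Finset V) (η' : ℝ),
      (∀ T : Finset V, (prodBernoulli W).real (⋃ t ∈ T, openConn S.Γ.root t) ≤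
        (prodBernoulli (pinW (KNLevels.lattW G S.p) ↑(S.U₀ G) ↑(S.U₀ G))).real
          (⋃ t ∈ (↑T : Set V), openConnIn (↑(S.Γ.Q S.Γ.a₀ 0 ∪ S.Γ.Ewv S.Γ.a₀ 0 du) : Set V) S.Γ.root t)) ∧
      (∀ i : Fin (Sc.N + 1), (s i).L.o = S.Γ.root) ∧
      (∀ i : Fin Sc.N, T' (Fin.castSucc i) ⊆ (s i.succ).L.X 0) ∧ (∀ i : Fin (Sc.N + 1), T' i ⊆ (s i).T) ∧
      (∀ i : Fin (Sc.N + 1), (s i).KitsAtF W S.p Δ' δ) ∧ η' ≤ δ / 2 ∧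
      (∀ i : Fin (Sc.N + 1), (prodBernoulli W).real (⋃ t ∈ (s i).T \ T' i, openConn S.Γ.root t) ≤ η') ∧
      1 - δ < (prodBernoulli W).real (s 0).L.reachB ∧
      T' (Fin.last Sc.N) ⊆ S.Γ.M S.Γ.a₀ ((0 : Site 2) + stepVec du) := by
  set U' : Finset V := (S.U0root du).filter fun y => y ∈ graphBall G S.Γ.root R with hU'
  -- the chain data of the root leg
  set Pd : WinChainData V := ⟨Rlev, Nk, j₀, j₁, S.Γ.root, U', fun k => rootRim (G := G) S.Γ.root R Pk.r₀ (Win G (runX φ c₀ n hs σ) S.Γ.root (Sc.region k) R)⟩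
    with hPd
  have hZR : ∀ u ∈ Λc S.Γ.root kz, u ∈ graphBall G S.Γ.root R := fun u hu => graphBall_mono G S.Γ.root hρR (hZρ u hu)
  -- the rim excess under the root-seed law, region by region
  have hexc : ∀ k ≤ Sc.N, (prodBernoulli (S.W0pin G (edgesIn G (Λc S.Γ.root kz)) U')).real (⋃ t' ∈ Pd.Rim k, openConn S.Γ.root t') ≤ η := by
    intro k hk
    have hDU : Win G (runX φ c₀ n hs σ) S.Γ.root (Sc.region k) R ⊆ U' := fun u hu => by
      obtain ⟨hub, huR⟩ := (mem_Win (G := G) (φ := runX φ c₀ n hs σ)).1 hu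
      exact Finset.mem_filter.2 ⟨hreg k hk u hub huR, hub⟩
    exact real_rootRim_le (S := S) (du := du) (hcz S.Γ.root) hZρ hDU (hdis k hk) hR₁ hR₁R hDm
  exact rootChainF_of_schedNZ du hlipφ hstep hΔ hfr hκ hn c₀ hσ hκL Sc Pk hPN hA hdD hDρ hKCmax hT hr₀ hR hrs hcS hreach Rg hRg hRgcard hcU1 Λc kz
    hΛRg hzconn hcz hkz hRk hΛcyl Pd rfl rfl hj0 hj hRl hE hδ hη kk hN hk hcount hZQ hZR hQU hlink hreg hdis (fun k => rootRim_subset (G := G) _ _ _ _)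
    (fun k _ v hv hfar => Finset.mem_filter.2 ⟨hv, hfar⟩) hTne hlastM hexc hrouteS

/-- **THE ROOT LEG ALONG THE FIRST AXIS OVER THE K-G CORRIDOR OF RECORD, window at the root, chain data built, rim excess discharged**
(`rootChainF_of_kgCorr` through `rootChainF_of_schedNZE`). [cite: KozmaNitzan2024, §4 p. 28 ((32) at the root), Lemma 12 (pp. 23–25)] -/
theorem rootChainF_of_kgCorrE
    -- the scheme, the direction
    {A : Type*} {S : KSchA V A} (du : MDir)
    -- the skeleton map, the frame
    (hlipφ : Lip G φ) (hstep : Steps G φ) {Δ : ℕ} (hΔ : ∀ v, G.degree v ≤ Δ) {types : Finset V} (hfr : Frames G φ types) (hκ : CylConn G φ types)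
    {n ℓ : ℕ} {hs v : ℤ} (hn : 1 ≤ n) (c₀ : V) {σ : ℤ} (hσ : σ = 1 ∨ σ = -1) {kq : ℕ} (hκL : hs.natAbs ≤ kq * n)
    -- the K-G corridor of record (first axis), the window
    {R' ρ qq Wd N m₁ Wm₂ Wp₂ m₂ : ℕ}
    (hP₁ : ParkOK (kgPark₁ n ℓ hs v R' ρ qq Wd N m₁)) (hP₂ : ParkOK (kgPark₂ n ℓ hs v R' ρ qq Wd N m₁ Wm₂ Wp₂ m₂))
    (hsplit : (Wm₂ : ℤ) + Wp₂ = (kgPark₁ n ℓ hs v R' ρ qq Wd N m₁).aHi (m₁ + 1) - ParkPrm.aLo (kgPark₁ n ℓ hs v R' ρ qq Wd N m₁) (m₁ + 1))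
    {R r Rl : ℕ} (hr : Rl ≤ r) (hrR : r ≤ R)
    -- kit constants
    (Pk : ApronPrm) {Mz Rs KCmax rs cS cU : ℕ} (hPN : kq + 3 ≤ Pk.N) (hA : Pk.A = (Mz + 1 : ℕ) * (shearUnit n hs : ℤ) + 1)
    (hdD : Pk.d + 2 ≤ shellD Pk) (hDρ : Rs + 1 ≤ shellD Pk) (hKCmax : (shellD Pk + Mz + 1) * (kq + 1) ≤ KCmax)
    (hT : (shellD Pk : ℤ) + KCmax + Rs ≤ tanOff Pk.ℓs Pk.M)
    (hr₀ : Pk.N * (tanOff Pk.ℓs Pk.M + 2) + Pk.N * Pk.d + (KCmax + Rs) ≤ Pk.r₀) (hR : Pk.r₀ ≤ R)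
    (hrs : 1 + (Pk.N * (tanOff Pk.ℓs Pk.M + 2) + Pk.N * Pk.d + (KCmax + Rs)) ≤ rs)
    (hcS : (Pk.N + 1) * (tanOff Pk.ℓs Pk.M + 1) + (Pk.N + 1) * Pk.d + (KCmax + 1) + cU ≤ cS)
    (hreach : r + (Pk.N * (tanOff Pk.ℓs Pk.M + 1) + Pk.N * Pk.d + KCmax) ≤ Pk.r₀)
    -- the short region and the zone datum
    (Rg : V → Finset V) (hRg : ∀ c, ∀ u ∈ Rg c, u ∈ graphBall G c Rs) (hRgcard : ∀ c, (Rg c).card ≤ cU) (hcU1 : 1 ≤ cU)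
    (Λc : V → ℕ → Finset V) (kz : ℕ) (hΛRg : ∀ c, Λc c kz ⊆ Rg c) (hzconn : ∀ c, ∀ s ∈ Λc c kz, PathIn G (↑(Λc c kz) : Set V) c s)
    (hcz : ∀ c, c ∈ Λc c kz) {Rk : ℕ} (hkz : 1 ≤ kz) (hRk : cylRadMax G φ types kz (2 * KCmax) ≤ Rk) (hΛcyl : ∀ c, cylBallFin G φ c kz Rk ⊆ Λc c kz)
    -- the chain's level data (the chain data is built inside: source the root, support the world, rim := `rootRim root R Pk.r₀ (window k)`)
    {Rlev Nk j₀ j₁ : ℕ} (hj0 : tanOff Pk.ℓs Pk.M ≤ j₀) (hj : j₁ ≤ Rlev) (hRl : Rlev + 1 ≤ (kgCorrSched hP₁ hP₂ hsplit).R')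
    (hE : j₁ + (Pk.N * (tanOff Pk.ℓs Pk.M + 1) + Pk.N * Pk.d + KCmax) ≤ (kgCorrSched hP₁ hP₂ hsplit).R')
    {Δ' : ℕ} {δ η : ℝ} (hδ : 0 < δ) (hη : η ≤ δ / 2)
    (kk : ℕ) (hN : kk * (Δ + 1) ^ (2 * rs) ≤ Nk) (hk : (1 - (S.p : ℝ) ^ (1 + Δ * cS + cS * cU)) ^ kk ≤ δ)
    (hcount : 1 / (1 - (S.p : ℝ)) ^ (Δ' * Nk) ≤ δ * ((Finset.Icc j₀ j₁).card : ℝ))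
    -- THE SEED := THE ZONE AT THE ROOT `Λc root kz` inside the root cube and the window ball; the hop prism `Qp` in the world; the hop into the first core window
    (hZQ : Λc S.Γ.root kz ⊆ S.Γ.Q S.Γ.a₀ 0) {ρ : ℕ} (hZρ : ∀ u ∈ Λc S.Γ.root kz, u ∈ graphBall G S.Γ.root ρ) (hρR : ρ ≤ R)
    {Qp : Finset V} (hQU : Qp ⊆ (S.U0root du).filter fun y => y ∈ graphBall G S.Γ.root R)
    (hlink : 1 - δ < (bondPercolation G S.p).real (linkIn (↑Qp : Set V) (Λc S.Γ.root kz) (Win G (runX φ c₀ n hs σ) S.Γ.root (ScheduleNP.core (kgCorrSched hP₁ hP₂ hsplit) 0) R)))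
    -- the world rows (vertex form): every region window lies in `Q₀ ∪ E_{0,du}` and clears the seed; the rim; depth; the arrival cube
    (hreg : ∀ k ≤ (kgCorrSched hP₁ hP₂ hsplit).N, ∀ u ∈ graphBall G S.Γ.root R, runX φ c₀ n hs σ u ∈ (kgCorrSched hP₁ hP₂ hsplit).region k → u ∈ S.U0root du)
    (hdis : ∀ k ≤ (kgCorrSched hP₁ hP₂ hsplit).N, Disjoint (Win G (runX φ c₀ n hs σ) S.Γ.root ((kgCorrSched hP₁ hP₂ hsplit).region k) R) (Λc S.Γ.root kz))
    (hTne : ∀ k ≤ (kgCorrSched hP₁ hP₂ hsplit).N, (Win G (runX φ c₀ n hs σ) S.Γ.root (ScheduleNP.core (kgCorrSched hP₁ hP₂ hsplit) (k + 1)) R).Nonempty)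
    (hlastM : ∀ u ∈ graphBall G S.Γ.root R, runX φ c₀ n hs σ u ∈ ScheduleNP.core (kgCorrSched hP₁ hP₂ hsplit) ((kgCorrSched hP₁ hP₂ hsplit).N + 1) → u ∈ S.Γ.M S.Γ.a₀ ((0 : Site 2) + stepVec du))
    -- THE RIM EXCESS DEVICE (replaces `hexc`): excess radius `R₁ ≤ R − Pk.r₀` at `S.p` for entrance depth `ρ + 1` and planar diameter `m` in `φe`; the cut world's diameter
    {φe : V → Site 2} {m R₁ : ℕ}
    (hR₁ : ∀ R', R₁ ≤ R' → ∀ (Rw : ℕ) (D' B' : Finset V), (∀ d ∈ D', d ∈ graphBall G S.Γ.root Rw) →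
      (∀ d ∈ D', ∀ d' ∈ D', φe d - φe d' ∈ box 2 m) → B' ⊆ D' → (∀ a ∈ B', a ∈ graphBall G S.Γ.root (ρ + 1)) →
        (bondPercolation G S.p).real (Skel.excess G S.Γ.root R' D' B') ≤ η)
    (hR₁R : R₁ ≤ R - Pk.r₀)
    (hDm : ∀ d ∈ ((S.U0root du).filter fun y => y ∈ graphBall G S.Γ.root R) \ Λc S.Γ.root kz,
      ∀ d' ∈ ((S.U0root du).filter fun y => y ∈ graphBall G S.Γ.root R) \ Λc S.Γ.root kz, φe d - φe d' ∈ box 2 m)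
    -- THE LONG LINKS AT EVERY CENTRE at accuracy `δ³` under `P_p` (the (S0) Step-I‴ inputs; the route input is p5-g15's `hrouteSW_kgCorr`)
    (hlong : ∀ c (τ : ℤ), τ = 1 ∨ τ = -1 → 1 - δ ^ 3 < (bondPercolation G S.p).real
      (linkIn (pgramPrism G φ c n hs (3 * ℓ) Rl) (Λc c kz) (pgSideHalfW G φ c n hs ℓ Rl σ (σ * τ))))
    (hlongY : ∀ c (τ : ℤ), τ = 1 ∨ τ = -1 → 1 - δ ^ 3 < (bondPercolation G S.p).real
      (linkIn (pgramPrism G φ c n hs (3 * ℓ) Rl) (Λc c kz) (pgTopPieceW G φ c n hs ℓ Rl σ τ v))) :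
    ∃ (c : V) (Rπ : ℕ) (W : Sym2 V → unitInterval) (s : Fin ((kgCorrSched hP₁ hP₂ hsplit).N + 1) → KNLevels.TStep (winGraph G c Rπ))
      (T' : Fin ((kgCorrSched hP₁ hP₂ hsplit).N + 1) → Finset V) (η' : ℝ),
      (∀ T : Finset V, (prodBernoulli W).real (⋃ t ∈ T, openConn S.Γ.root t) ≤
        (prodBernoulli (pinW (KNLevels.lattW G S.p) ↑(S.U₀ G) ↑(S.U₀ G))).real
          (⋃ t ∈ (↑T : Set V), openConnIn (↑(S.Γ.Q S.Γ.a₀ 0 ∪ S.Γ.Ewv S.Γ.a₀ 0 du) : Set V) S.Γ.root t)) ∧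
      (∀ i : Fin ((kgCorrSched hP₁ hP₂ hsplit).N + 1), (s i).L.o = S.Γ.root) ∧
      (∀ i : Fin (kgCorrSched hP₁ hP₂ hsplit).N, T' (Fin.castSucc i) ⊆ (s i.succ).L.X 0) ∧ (∀ i : Fin ((kgCorrSched hP₁ hP₂ hsplit).N + 1), T' i ⊆ (s i).T) ∧
      (∀ i : Fin ((kgCorrSched hP₁ hP₂ hsplit).N + 1), (s i).KitsAtF W S.p Δ' δ) ∧ η' ≤ δ / 2 ∧
      (∀ i : Fin ((kgCorrSched hP₁ hP₂ hsplit).N + 1), (prodBernoulli W).real (⋃ t ∈ (s i).T \ T' i, openConn S.Γ.root t) ≤ η') ∧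
      1 - δ < (prodBernoulli W).real (s 0).L.reachB ∧
      T' (Fin.last (kgCorrSched hP₁ hP₂ hsplit).N) ⊆ S.Γ.M S.Γ.a₀ ((0 : Site 2) + stepVec du) := by
  have hZR : ∀ u ∈ Λc S.Γ.root kz, u ∈ graphBall G S.Γ.root R := fun u hu => graphBall_mono G S.Γ.root hρR (hZρ u hu)
  -- the region windows lie in the world and clear the seed, so the root-seed law is a subbox law there
  have hWD : ∀ k ≤ (kgCorrSched hP₁ hP₂ hsplit).N, IsSubbox (winGraph G S.Γ.root R)
      (S.W0pin G (edgesIn G (Λc S.Γ.root kz)) ((S.U0root du).filter fun y => y ∈ graphBall G S.Γ.root R)) S.p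
      (Win G (runX φ c₀ n hs σ) S.Γ.root ((kgCorrSched hP₁ hP₂ hsplit).region k) R) := by
    intro k hk
    refine Skel.isSubbox_W0pin_win (S := S) S.Γ.root R (fun u hu => ?_) (fresh_of_disjoint (fun e he w hw => (mem_edgesIn_iff.1 he).2 w hw) (hdis k hk))
    obtain ⟨hub, huR⟩ := (mem_Win (G := G) (φ := runX φ c₀ n hs σ)).1 hu
    exact Finset.mem_filter.2 ⟨hreg k hk u hub huR, hub⟩
  exact rootChainF_of_schedNZE du hlipφ hstep hΔ hfr hκ hn c₀ hσ hκL (kgCorrSched hP₁ hP₂ hsplit) Pk hPN hA hdD hDρ hKCmax hT hr₀ hR hrs hcS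
    hreach Rg hRg hRgcard hcU1 Λc kz hΛRg hzconn hcz hkz hRk hΛcyl hj0 hj hRl hE hδ hη kk hN hk hcount hZQ hZρ hρR hQU hlink
    hreg hdis hTne hlastM hR₁ hR₁R hDm
    (hrouteSW_kgCorr hP₁ hP₂ hsplit hn c₀ hσ hr hrR (fun k => rootRim (G := G) S.Γ.root R Pk.r₀ (Win G (runX φ c₀ n hs σ) S.Γ.root ((kgCorrSched hP₁ hP₂ hsplit).region k) R)) hWD Λc kz hlong hlongY)

/-- **THE ROOT LEG ALONG THE SECOND AXIS OVER THE K-G CORRIDOR OF RECORD, window at the root, chain data built, rim excess discharged**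
(`rootChainF_of_kgCorrY` through `rootChainF_of_schedNZE`). [cite: KozmaNitzan2024, §4 p. 28 ((32) at the root), Lemma 12 (pp. 23–25)] -/
theorem rootChainF_of_kgCorrYE
    -- the scheme, the direction
    {A : Type*} {S : KSchA V A} (du : MDir)
    -- the skeleton map, the frame
    (hlipφ : Lip G φ) (hstep : Steps G φ) {Δ : ℕ} (hΔ : ∀ v, G.degree v ≤ Δ) {types : Finset V} (hfr : Frames G φ types) (hκ : CylConn G φ types)
    {n ℓ : ℕ} {hs v : ℤ} (hn : 1 ≤ n) (hv : |v| ≤ n) (hlay : (n + hs.natAbs : ℕ) ≤ (n : ℤ) * ℓ + 1) (c₀ : V) {σ : ℤ} (hσ : σ = 1 ∨ σ = -1) {kq : ℕ} (hκL : hs.natAbs ≤ kq * n)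
    -- the K-G corridor of record (second axis), the window
    {R' ρ qq Wd N m₁ Wm₂ Wp₂ m₂ : ℕ}
    (hP₁ : ParkOK (kgPark₁Y n ℓ hs v R' ρ qq Wd N m₁)) (hP₂ : ParkOK (kgPark₂Y n ℓ hs v R' ρ qq Wd N m₁ Wm₂ Wp₂ m₂))
    (hsplit : (Wm₂ : ℤ) + Wp₂ = (kgPark₁Y n ℓ hs v R' ρ qq Wd N m₁).aHi (m₁ + 1) - ParkPrm.aLo (kgPark₁Y n ℓ hs v R' ρ qq Wd N m₁) (m₁ + 1))
    {R r Rl : ℕ} (hr : Rl ≤ r) (hrR : r ≤ R)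
    -- kit constants
    (Pk : ApronPrm) {Mz Rs KCmax rs cS cU : ℕ} (hPN : kq + 3 ≤ Pk.N) (hA : Pk.A = (Mz + 1 : ℕ) * (shearUnit n hs : ℤ) + 1)
    (hdD : Pk.d + 2 ≤ shellD Pk) (hDρ : Rs + 1 ≤ shellD Pk) (hKCmax : (shellD Pk + Mz + 1) * (kq + 1) ≤ KCmax)
    (hT : (shellD Pk : ℤ) + KCmax + Rs ≤ tanOff Pk.ℓs Pk.M)
    (hr₀ : Pk.N * (tanOff Pk.ℓs Pk.M + 2) + Pk.N * Pk.d + (KCmax + Rs) ≤ Pk.r₀) (hR : Pk.r₀ ≤ R)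
    (hrs : 1 + (Pk.N * (tanOff Pk.ℓs Pk.M + 2) + Pk.N * Pk.d + (KCmax + Rs)) ≤ rs)
    (hcS : (Pk.N + 1) * (tanOff Pk.ℓs Pk.M + 1) + (Pk.N + 1) * Pk.d + (KCmax + 1) + cU ≤ cS)
    (hreach : r + (Pk.N * (tanOff Pk.ℓs Pk.M + 1) + Pk.N * Pk.d + KCmax) ≤ Pk.r₀)
    -- the short region and the zone datum
    (Rg : V → Finset V) (hRg : ∀ c, ∀ u ∈ Rg c, u ∈ graphBall G c Rs) (hRgcard : ∀ c, (Rg c).card ≤ cU) (hcU1 : 1 ≤ cU)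
    (Λc : V → ℕ → Finset V) (kz : ℕ) (hΛRg : ∀ c, Λc c kz ⊆ Rg c) (hzconn : ∀ c, ∀ s ∈ Λc c kz, PathIn G (↑(Λc c kz) : Set V) c s)
    (hcz : ∀ c, c ∈ Λc c kz) {Rk : ℕ} (hkz : 1 ≤ kz) (hRk : cylRadMax G φ types kz (2 * KCmax) ≤ Rk) (hΛcyl : ∀ c, cylBallFin G φ c kz Rk ⊆ Λc c kz)
    -- the chain's level data (the chain data is built inside: source the root, support the world, rim := `rootRim root R Pk.r₀ (window k)`)
    {Rlev Nk j₀ j₁ : ℕ} (hj0 : tanOff Pk.ℓs Pk.M ≤ j₀) (hj : j₁ ≤ Rlev) (hRl : Rlev + 1 ≤ (kgCorrSchedY hn hv hlay hP₁ hP₂ hsplit).R')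
    (hE : j₁ + (Pk.N * (tanOff Pk.ℓs Pk.M + 1) + Pk.N * Pk.d + KCmax) ≤ (kgCorrSchedY hn hv hlay hP₁ hP₂ hsplit).R')
    {Δ' : ℕ} {δ η : ℝ} (hδ : 0 < δ) (hη : η ≤ δ / 2)
    (kk : ℕ) (hN : kk * (Δ + 1) ^ (2 * rs) ≤ Nk) (hk : (1 - (S.p : ℝ) ^ (1 + Δ * cS + cS * cU)) ^ kk ≤ δ)
    (hcount : 1 / (1 - (S.p : ℝ)) ^ (Δ' * Nk) ≤ δ * ((Finset.Icc j₀ j₁).card : ℝ))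
    -- THE SEED := THE ZONE AT THE ROOT `Λc root kz` inside the root cube and the window ball; the hop prism `Qp` in the world; the hop into the first core window
    (hZQ : Λc S.Γ.root kz ⊆ S.Γ.Q S.Γ.a₀ 0) {ρ : ℕ} (hZρ : ∀ u ∈ Λc S.Γ.root kz, u ∈ graphBall G S.Γ.root ρ) (hρR : ρ ≤ R)
    {Qp : Finset V} (hQU : Qp ⊆ (S.U0root du).filter fun y => y ∈ graphBall G S.Γ.root R)
    (hlink : 1 - δ < (bondPercolation G S.p).real (linkIn (↑Qp : Set V) (Λc S.Γ.root kz) (Win G (runX φ c₀ n hs σ) S.Γ.root (ScheduleNP.core (kgCorrSchedY hn hv hlay hP₁ hP₂ hsplit) 0) R)))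
    -- the world rows (vertex form): every region window lies in `Q₀ ∪ E_{0,du}` and clears the seed; the rim; depth; the arrival cube
    (hreg : ∀ k ≤ (kgCorrSchedY hn hv hlay hP₁ hP₂ hsplit).N, ∀ u ∈ graphBall G S.Γ.root R, runX φ c₀ n hs σ u ∈ (kgCorrSchedY hn hv hlay hP₁ hP₂ hsplit).region k → u ∈ S.U0root du)
    (hdis : ∀ k ≤ (kgCorrSchedY hn hv hlay hP₁ hP₂ hsplit).N, Disjoint (Win G (runX φ c₀ n hs σ) S.Γ.root ((kgCorrSchedY hn hv hlay hP₁ hP₂ hsplit).region k) R) (Λc S.Γ.root kz))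
    (hTne : ∀ k ≤ (kgCorrSchedY hn hv hlay hP₁ hP₂ hsplit).N, (Win G (runX φ c₀ n hs σ) S.Γ.root (ScheduleNP.core (kgCorrSchedY hn hv hlay hP₁ hP₂ hsplit) (k + 1)) R).Nonempty)
    (hlastM : ∀ u ∈ graphBall G S.Γ.root R, runX φ c₀ n hs σ u ∈ ScheduleNP.core (kgCorrSchedY hn hv hlay hP₁ hP₂ hsplit) ((kgCorrSchedY hn hv hlay hP₁ hP₂ hsplit).N + 1) → u ∈ S.Γ.M S.Γ.a₀ ((0 : Site 2) + stepVec du))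
    -- THE RIM EXCESS DEVICE (replaces `hexc`): excess radius `R₁ ≤ R − Pk.r₀` at `S.p` for entrance depth `ρ + 1` and planar diameter `m` in `φe`; the cut world's diameter
    {φe : V → Site 2} {m R₁ : ℕ}
    (hR₁ : ∀ R', R₁ ≤ R' → ∀ (Rw : ℕ) (D' B' : Finset V), (∀ d ∈ D', d ∈ graphBall G S.Γ.root Rw) →
      (∀ d ∈ D', ∀ d' ∈ D', φe d - φe d' ∈ box 2 m) → B' ⊆ D' → (∀ a ∈ B', a ∈ graphBall G S.Γ.root (ρ + 1)) →
        (bondPercolation G S.p).real (Skel.excess G S.Γ.root R' D' B') ≤ η)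
    (hR₁R : R₁ ≤ R - Pk.r₀)
    (hDm : ∀ d ∈ ((S.U0root du).filter fun y => y ∈ graphBall G S.Γ.root R) \ Λc S.Γ.root kz,
      ∀ d' ∈ ((S.U0root du).filter fun y => y ∈ graphBall G S.Γ.root R) \ Λc S.Γ.root kz, φe d - φe d' ∈ box 2 m)
    -- THE LONG LINKS AT EVERY CENTRE at accuracy `δ³` under `P_p` (the (S0) Step-I‴ inputs; the route input is p5-g15's `hrouteSW_kgCorr`)
    (hlong : ∀ c (τ : ℤ), τ = 1 ∨ τ = -1 → 1 - δ ^ 3 < (bondPercolation G S.p).real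
      (linkIn (pgramPrism G φ c n hs (3 * ℓ) Rl) (Λc c kz) (pgSideHalfW G φ c n hs ℓ Rl σ (σ * τ))))
    (hlongY : ∀ c (τ : ℤ), τ = 1 ∨ τ = -1 → 1 - δ ^ 3 < (bondPercolation G S.p).real
      (linkIn (pgramPrism G φ c n hs (3 * ℓ) Rl) (Λc c kz) (pgTopPieceW G φ c n hs ℓ Rl σ τ v))) :
    ∃ (c : V) (Rπ : ℕ) (W : Sym2 V → unitInterval) (s : Fin ((kgCorrSchedY hn hv hlay hP₁ hP₂ hsplit).N + 1) → KNLevels.TStep (winGraph G c Rπ))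
      (T' : Fin ((kgCorrSchedY hn hv hlay hP₁ hP₂ hsplit).N + 1) → Finset V) (η' : ℝ),
      (∀ T : Finset V, (prodBernoulli W).real (⋃ t ∈ T, openConn S.Γ.root t) ≤
        (prodBernoulli (pinW (KNLevels.lattW G S.p) ↑(S.U₀ G) ↑(S.U₀ G))).real
          (⋃ t ∈ (↑T : Set V), openConnIn (↑(S.Γ.Q S.Γ.a₀ 0 ∪ S.Γ.Ewv S.Γ.a₀ 0 du) : Set V) S.Γ.root t)) ∧
      (∀ i : Fin ((kgCorrSchedY hn hv hlay hP₁ hP₂ hsplit).N + 1), (s i).L.o = S.Γ.root) ∧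
      (∀ i : Fin (kgCorrSchedY hn hv hlay hP₁ hP₂ hsplit).N, T' (Fin.castSucc i) ⊆ (s i.succ).L.X 0) ∧ (∀ i : Fin ((kgCorrSchedY hn hv hlay hP₁ hP₂ hsplit).N + 1), T' i ⊆ (s i).T) ∧
      (∀ i : Fin ((kgCorrSchedY hn hv hlay hP₁ hP₂ hsplit).N + 1), (s i).KitsAtF W S.p Δ' δ) ∧ η' ≤ δ / 2 ∧
      (∀ i : Fin ((kgCorrSchedY hn hv hlay hP₁ hP₂ hsplit).N + 1), (prodBernoulli W).real (⋃ t ∈ (s i).T \ T' i, openConn S.Γ.root t) ≤ η') ∧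
      1 - δ < (prodBernoulli W).real (s 0).L.reachB ∧
      T' (Fin.last (kgCorrSchedY hn hv hlay hP₁ hP₂ hsplit).N) ⊆ S.Γ.M S.Γ.a₀ ((0 : Site 2) + stepVec du) := by
  have hZR : ∀ u ∈ Λc S.Γ.root kz, u ∈ graphBall G S.Γ.root R := fun u hu => graphBall_mono G S.Γ.root hρR (hZρ u hu)
  -- the region windows lie in the world and clear the seed, so the root-seed law is a subbox law there
  have hWD : ∀ k ≤ (kgCorrSchedY hn hv hlay hP₁ hP₂ hsplit).N, IsSubbox (winGraph G S.Γ.root R)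
      (S.W0pin G (edgesIn G (Λc S.Γ.root kz)) ((S.U0root du).filter fun y => y ∈ graphBall G S.Γ.root R)) S.p
      (Win G (runX φ c₀ n hs σ) S.Γ.root ((kgCorrSchedY hn hv hlay hP₁ hP₂ hsplit).region k) R) := by
    intro k hk
    refine Skel.isSubbox_W0pin_win (S := S) S.Γ.root R (fun u hu => ?_) (fresh_of_disjoint (fun e he w hw => (mem_edgesIn_iff.1 he).2 w hw) (hdis k hk))
    obtain ⟨hub, huR⟩ := (mem_Win (G := G) (φ := runX φ c₀ n hs σ)).1 hu
    exact Finset.mem_filter.2 ⟨hreg k hk u hub huR, hub⟩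
  exact rootChainF_of_schedNZE du hlipφ hstep hΔ hfr hκ hn c₀ hσ hκL (kgCorrSchedY hn hv hlay hP₁ hP₂ hsplit) Pk hPN hA hdD hDρ hKCmax hT hr₀ hR hrs hcS
    hreach Rg hRg hRgcard hcU1 Λc kz hΛRg hzconn hcz hkz hRk hΛcyl hj0 hj hRl hE hδ hη kk hN hk hcount hZQ hZρ hρR hQU hlink
    hreg hdis hTne hlastM hR₁ hR₁R hDm
    (hrouteSW_kgCorrY hn hv hlay hP₁ hP₂ hsplit c₀ hσ hr hrR (fun k => rootRim (G := G) S.Γ.root R Pk.r₀ (Win G (runX φ c₀ n hs σ) S.Γ.root ((kgCorrSchedY hn hv hlay hP₁ hP₂ hsplit).region k) R)) hWD Λc kz hlong hlongY)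

end Skelφ

end Transplant

end Summit.CriticalPhenomena.PercolationContinuityZ3.Theorems

end
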